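import Mathlib
import HarnessLib

/-!
# The weighted pairing `Σ_i w_i x_i y_i` on `ℤ^ι` and weight-symmetric integer matrices

Topic `NumberTheory/Automorphic`; theorems only (no definition, no named fact, no instance).
For a finite index type `ι` and weights `w : ι → ℕ` the pairing `⟪x, y⟫_w = Σ_i w_i x_i y_i` on
`ℤ^ι` is Gross's height pairing on the Brandt module `ℤ[Cls O]` of a definite quaternion order,
written in the basis of ideal classes (`⟨e_i, e_j⟩ = w_i δ_ij`, `w_i = #O_L(I_i)ˣ / 2`; Gross 1987
§§1–4, Pollack–Weston 2011 §2.1, where `ξ_f = ⟨g_f, g_f⟩`), and an integer matrix `X` is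
self-adjoint for it iff it is **`w`-symmetric**, `w_i X_ij = w_j X_ji` — the classical symmetry of
the Brandt matrices (Eichler; Voight 41.1; in the tree `Brandt.XiSetup.weight_mul_matrix_symm`,
`BrandtModuleWeightSymmProofs.lean`).  This file is the elementary bookkeeping consumed by
`BrandtHeckeProjector.lean` (an integral Hecke multiple of the projector onto an eigen-line):

* `wpair_*` — linearity in each variable (`wpair_smul_left`, `wpair_smul_right`,
  `wpair_sum_left`), the value on a basis vector (`wpair_single_left`), positivity
  `⟪x, x⟫_w ≥ 0` with equality only at `x = 0` when all `w_i > 0` (`wpair_self_nonneg`,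
  `eq_zero_of_wpair_self_eq_zero`), and **self-adjointness of `w`-symmetric matrices**,
  `⟪X x, y⟫_w = ⟪x, X y⟫_w` (`wpair_mulVec`);
* `wsymm_*` — the `w`-symmetric matrices contain `0` and `1` and are closed under sums,
  differences, integer multiples, finite sums, products of COMMUTING pairs, powers and integer
  polynomials (`wsymm_aeval`);
* `aeval_mulVec_of_mulVec_eq_zero` — `p(X) v = p(0) v` whenever `X v = 0`.

Design.  No definition (and no notation) is introduced: the pairing is always the explicit sum
`∑ i, (w i : ℤ) * x i * y i` (written `⟪x, y⟫_w` in the docstrings only) and `w`-symmetry is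
the explicit hypothesis `∀ i j, (w i : ℤ) * X i j = (w j : ℤ) * X j i`, so that users see and
rewrite with exactly these expressions.  Everything is over `ℤ` with `ℕ`-valued weights, the
generality of the application (`Brandt.weight`, `Brandt.matrix`); neither commutativity of the
matrices among themselves nor non-degeneracy over `ℚ` is used or stated.

What is NOT here: the Brandt matrices (`BrandtXi.lean`), their `w`-symmetry
(`BrandtModuleWeightSymmProofs.lean`), positivity of the Brandt weights
(`DefiniteOrderUnitsFinite.lean`), Gram determinants, adjoints of non-symmetric matrices.

## References

* B. H. Gross, *Heights and the special values of L-series*, CMS Conf. Proc. 7 (1987), §§1–4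
  [Gross1987].
* R. Pollack, T. Weston, *On anticyclotomic μ-invariants of modular forms*, Compos. Math. 147
  (2011), §2.1 [PollackWeston2011].
* J. Voight, *Quaternion Algebras*, GTM 288 (2021), §41.1 [Voight2021].
-/

open scoped Matrix
open Polynomial

namespace Literature.NumberTheory.Automorphic

namespace Brandt

variable {ι : Type*}

/-! ### The pairing `⟪x, y⟫_w = Σ_i w_i x_i y_i` -/

section Pairing

variable [Fintype ι]

/-- `⟪0, y⟫_w = 0` for the weighted pairing `⟪x, y⟫_w = Σ_i w_i x_i y_i` on `ℤ^ι`. [folklore] -/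
theorem wpair_zero_left (w : ι → ℕ) (y : ι → ℤ) :
    ∑ i, (w i : ℤ) * (0 : ι → ℤ) i * y i = 0 :=
  Finset.sum_eq_zero fun i _ => by simp

/-- `⟪c x, y⟫_w = c ⟪x, y⟫_w`. [folklore] -/
theorem wpair_smul_left (w : ι → ℕ) (c : ℤ) (x y : ι → ℤ) :
    ∑ i, (w i : ℤ) * (c • x) i * y i = c * ∑ i, (w i : ℤ) * x i * y i := by
  rw [Finset.mul_sum]
  exact Finset.sum_congr rfl fun i _ => by simp only [Pi.smul_apply, smul_eq_mul]; ring

/-- `⟪x, c y⟫_w = c ⟪x, y⟫_w`. [folklore] -/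
theorem wpair_smul_right (w : ι → ℕ) (c : ℤ) (x y : ι → ℤ) :
    ∑ i, (w i : ℤ) * x i * (c • y) i = c * ∑ i, (w i : ℤ) * x i * y i := by
  rw [Finset.mul_sum]
  exact Finset.sum_congr rfl fun i _ => by simp only [Pi.smul_apply, smul_eq_mul]; ring

/-- `⟪Σ_{a ∈ s} f a, y⟫_w = Σ_{a ∈ s} ⟪f a, y⟫_w`. [folklore] -/
theorem wpair_sum_left {α : Type*} (w : ι → ℕ) (s : Finset α) (f : α → ι → ℤ) (y : ι → ℤ) :
    ∑ i, (w i : ℤ) * (∑ a ∈ s, f a) i * y i = ∑ a ∈ s, ∑ i, (w i : ℤ) * f a i * y i := by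
  rw [Finset.sum_comm]
  exact Finset.sum_congr rfl fun i _ => by
    rw [Finset.sum_apply, Finset.mul_sum, Finset.sum_mul]

/-- `⟪e_d, y⟫_w = w_d y_d` for the basis vector `e_d = Pi.single d 1`. [folklore] -/
theorem wpair_single_left [DecidableEq ι] (w : ι → ℕ) (d : ι) (y : ι → ℤ) :
    ∑ i, (w i : ℤ) * (Pi.single d 1 : ι → ℤ) i * y i = (w d : ℤ) * y d := by
  rw [Finset.sum_eq_single d]
  · simp
  · intro i _ hi
    simp [hi]
  · intro h
    exact absurd (Finset.mem_univ d) h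

/-- `⟪x, x⟫_w ≥ 0`. [folklore] -/
theorem wpair_self_nonneg (w : ι → ℕ) (x : ι → ℤ) :
    0 ≤ ∑ i, (w i : ℤ) * x i * x i :=
  Finset.sum_nonneg fun i _ => by
    rw [mul_assoc]
    exact mul_nonneg (Nat.cast_nonneg _) (mul_self_nonneg _)

/-- Positive weights make the pairing definite: `⟪x, x⟫_w = 0` forces `x = 0`. [folklore] -/
theorem eq_zero_of_wpair_self_eq_zero {w : ι → ℕ} (hw : ∀ i, 0 < w i) {x : ι → ℤ}
    (h : ∑ i, (w i : ℤ) * x i * x i = 0) : x = 0 := by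
  have hterm : ∀ i ∈ (Finset.univ : Finset ι), (0 : ℤ) ≤ (w i : ℤ) * x i * x i := fun i _ => by
    rw [mul_assoc]
    exact mul_nonneg (Nat.cast_nonneg _) (mul_self_nonneg _)
  have h' := (Finset.sum_eq_zero_iff_of_nonneg hterm).mp h
  funext i
  have hi := h' i (Finset.mem_univ i)
  rw [mul_assoc] at hi
  rcases mul_eq_zero.mp hi with h0 | h0
  · exact absurd h0 (by exact_mod_cast (hw i).ne')
  · exact mul_self_eq_zero.mp h0

/-- **Self-adjointness.**  A `w`-symmetric integer matrix `X` (`w_i X_ij = w_j X_ji`) is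
self-adjoint for the weighted pairing: `⟪X x, y⟫_w = ⟪x, X y⟫_w` (Gross 1987 §4 / Voight 41.1 for
the Brandt matrices). [folklore] -/
theorem wpair_mulVec (w : ι → ℕ) {X : Matrix ι ι ℤ}
    (hX : ∀ i j, (w i : ℤ) * X i j = (w j : ℤ) * X j i) (x y : ι → ℤ) :
    ∑ i, (w i : ℤ) * (X *ᵥ x) i * y i = ∑ i, (w i : ℤ) * x i * (X *ᵥ y) i := by
  simp only [Matrix.mulVec, dotProduct]
  calc ∑ i, (w i : ℤ) * (∑ j, X i j * x j) * y i
      = ∑ i, ∑ j, (w i : ℤ) * X i j * x j * y i := by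
        refine Finset.sum_congr rfl fun i _ => ?_
        rw [Finset.mul_sum, Finset.sum_mul]
        exact Finset.sum_congr rfl fun j _ => by ring
    _ = ∑ i, ∑ j, (w j : ℤ) * X j i * x j * y i := by
        refine Finset.sum_congr rfl fun i _ => Finset.sum_congr rfl fun j _ => ?_
        rw [hX i j]
    _ = ∑ j, ∑ i, (w j : ℤ) * X j i * x j * y i := Finset.sum_comm
    _ = ∑ j, (w j : ℤ) * x j * ∑ i, X j i * y i := by
        refine Finset.sum_congr rfl fun j _ => ?_
        rw [Finset.mul_sum]
        exact Finset.sum_congr rfl fun i _ => by ring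

end Pairing

/-! ### Closure properties of weight symmetry `w_i X_ij = w_j X_ji` -/

section WSymm

variable {w : ι → ℕ}

/-- The zero matrix is `w`-symmetric. [folklore] -/
theorem wsymm_zero (w : ι → ℕ) :
    ∀ i j, (w i : ℤ) * (0 : Matrix ι ι ℤ) i j = (w j : ℤ) * (0 : Matrix ι ι ℤ) j i :=
  fun i j => by simp

/-- The identity matrix is `w`-symmetric. [folklore] -/
theorem wsymm_one [DecidableEq ι] (w : ι → ℕ) :
    ∀ i j, (w i : ℤ) * (1 : Matrix ι ι ℤ) i j = (w j : ℤ) * (1 : Matrix ι ι ℤ) j i := fun i j => by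
  by_cases h : i = j
  · subst h; rfl
  · rw [Matrix.one_apply_ne h, Matrix.one_apply_ne (Ne.symm h), mul_zero, mul_zero]

/-- Sums of `w`-symmetric matrices are `w`-symmetric. [folklore] -/
theorem wsymm_add {X Y : Matrix ι ι ℤ} (hX : ∀ i j, (w i : ℤ) * X i j = (w j : ℤ) * X j i)
    (hY : ∀ i j, (w i : ℤ) * Y i j = (w j : ℤ) * Y j i) :
    ∀ i j, (w i : ℤ) * (X + Y) i j = (w j : ℤ) * (X + Y) j i :=
  fun i j => by simp only [Matrix.add_apply, mul_add, hX i j, hY i j]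

/-- Differences of `w`-symmetric matrices are `w`-symmetric. [folklore] -/
theorem wsymm_sub {X Y : Matrix ι ι ℤ} (hX : ∀ i j, (w i : ℤ) * X i j = (w j : ℤ) * X j i)
    (hY : ∀ i j, (w i : ℤ) * Y i j = (w j : ℤ) * Y j i) :
    ∀ i j, (w i : ℤ) * (X - Y) i j = (w j : ℤ) * (X - Y) j i :=
  fun i j => by simp only [Matrix.sub_apply, mul_sub, hX i j, hY i j]

/-- Integer multiples of `w`-symmetric matrices are `w`-symmetric. [folklore] -/
theorem wsymm_smul {X : Matrix ι ι ℤ} (hX : ∀ i j, (w i : ℤ) * X i j = (w j : ℤ) * X j i)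
    (c : ℤ) : ∀ i j, (w i : ℤ) * (c • X) i j = (w j : ℤ) * (c • X) j i :=
  fun i j => by
    simp only [Matrix.smul_apply, smul_eq_mul]
    rw [mul_left_comm, hX i j, mul_left_comm]

/-- Finite sums of `w`-symmetric matrices are `w`-symmetric. [folklore] -/
theorem wsymm_sum {α : Type*} {s : Finset α} {f : α → Matrix ι ι ℤ}
    (h : ∀ a ∈ s, ∀ i j, (w i : ℤ) * f a i j = (w j : ℤ) * f a j i) :
    ∀ i j, (w i : ℤ) * (∑ a ∈ s, f a) i j = (w j : ℤ) * (∑ a ∈ s, f a) j i :=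
  Finset.sum_induction f (fun X : Matrix ι ι ℤ => ∀ i j, (w i : ℤ) * X i j = (w j : ℤ) * X j i)
    (fun _ _ => wsymm_add) (wsymm_zero w) h

/-- The product of two COMMUTING `w`-symmetric matrices is `w`-symmetric. [folklore] -/
theorem wsymm_mul_of_commute [Fintype ι] {X Y : Matrix ι ι ℤ}
    (hX : ∀ i j, (w i : ℤ) * X i j = (w j : ℤ) * X j i)
    (hY : ∀ i j, (w i : ℤ) * Y i j = (w j : ℤ) * Y j i) (hc : X * Y = Y * X) :
    ∀ i j, (w i : ℤ) * (X * Y) i j = (w j : ℤ) * (X * Y) j i := fun i j => by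
  rw [show (X * Y) j i = (Y * X) j i by rw [hc]]
  simp only [Matrix.mul_apply, Finset.mul_sum]
  refine Finset.sum_congr rfl fun k _ => ?_
  calc (w i : ℤ) * (X i k * Y k j) = ((w i : ℤ) * X i k) * Y k j := by ring
    _ = ((w k : ℤ) * X k i) * Y k j := by rw [hX i k]
    _ = X k i * ((w k : ℤ) * Y k j) := by ring
    _ = X k i * ((w j : ℤ) * Y j k) := by rw [hY k j]
    _ = (w j : ℤ) * (Y j k * X k i) := by ring

/-- Powers of a `w`-symmetric matrix are `w`-symmetric. [folklore] -/
theorem wsymm_pow [Fintype ι] [DecidableEq ι] {X : Matrix ι ι ℤ}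
    (hX : ∀ i j, (w i : ℤ) * X i j = (w j : ℤ) * X j i) (n : ℕ) :
    ∀ i j, (w i : ℤ) * (X ^ n) i j = (w j : ℤ) * (X ^ n) j i := by
  induction n with
  | zero => rw [pow_zero]; exact wsymm_one w
  | succ n ih =>
    rw [pow_succ]
    exact wsymm_mul_of_commute ih hX (Commute.pow_self X n).eq

/-- Integer polynomials in a `w`-symmetric matrix are `w`-symmetric. [folklore] -/
theorem wsymm_aeval [Fintype ι] [DecidableEq ι] {X : Matrix ι ι ℤ}
    (hX : ∀ i j, (w i : ℤ) * X i j = (w j : ℤ) * X j i) (p : ℤ[X]) :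
    ∀ i j, (w i : ℤ) * (aeval X p) i j = (w j : ℤ) * (aeval X p) j i := by
  rw [aeval_eq_sum_range]
  exact wsymm_sum fun k _ => wsymm_smul (wsymm_pow hX k) _

end WSymm

/-! ### Polynomials in a matrix on its kernel -/

/-- Evaluating an integer polynomial `p` at a matrix `X` and applying the result to a vector
killed by `X` multiplies that vector by the constant term: `p(X) v = p(0) v`. [folklore] -/
theorem aeval_mulVec_of_mulVec_eq_zero [Fintype ι] [DecidableEq ι] (X : Matrix ι ι ℤ) (p : ℤ[X])
    {v : ι → ℤ} (hv : X *ᵥ v = 0) : (aeval X p) *ᵥ v = p.coeff 0 • v := by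
  conv_lhs => rw [← p.divX_mul_X_add]
  rw [map_add, map_mul, aeval_X, aeval_C, Matrix.add_mulVec, ← Matrix.mulVec_mulVec, hv,
    Matrix.mulVec_zero, zero_add, Algebra.algebraMap_eq_smul_one, Matrix.smul_mulVec,
    Matrix.one_mulVec]

end Brandt

end Literature.NumberTheory.Automorphic
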